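import Literature.MathematicalPhysics.QuantumFieldTheory.Balaban1983to89.Node00.Carriers3
import Literature.MathematicalPhysics.QuantumFieldTheory.Balaban1983to89.Node00.CarriersB6KDischarge

/-!
# NODE 00 (YM-PLAN Track A) — STAGE 3: the DAG node N03 ([Balaban1984PropagatorsII]) AT EVERY STAGE-3 WORLD OF RECORD MODULO EXACTLY THE
# PROP. 2.6 CENSUS — the composition of the Stage-3 chain (`Node00.Carriers3`) with seat dag-p1's discharges (`Node00.CarriersB6KDischarge`)

NODE 00 STAGE-3 MODULE (seat `pub-ymgap-node00-def` g27, 2026-08-25; theorems only; count-neutral).  `Node00.Carriers3.b6_main_of_isWorldOfRecord₃_of` displays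
the block's leaf `DagBinding.B6BlockParam (D6OfRecord θ)`; dag-p1's `Node00.CarriersB6KDischarge.b6BlockParam_tower_of_prop26` proves that leaf from the Prop. 2.6
census ALONE (Lemma 2.1-param, Props. 2.2 ∕ 2.3 ∕ 2.5 ∕ 2.7, Lemma 2.4, Cor. 2.8 discharged by name).  Since `D6OfRecord θ` IS `towerBlockOfRecord` at `θ`'s parameters
with the tree-gauge and local-operator carriers of record (`treeOfRecord`, `locOfRecord` unfold to dag-p1's lambdas), the two compose: **N03 · `Dag.B6_main (leavesP w P)`
at every Stage-3 world of record follows from `B6.Prop26Printed (kGeoG) (kG)` at the world's parameters** — the ONE estimate still open (r03's census form, six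
slots; hl3 kernel-clean by dag-p1 2026-08-25).  HONEST FRAMING: kernel bookkeeping; the displayed Prop. 2.6 census is OPEN in the tree; a landing here is NOT a node
discharge (species rule R414 (B)(v): the count moves on the hypothesis-free theorem + referee read + the leads' word); one finite T⁴ programme; NOT ℝ⁴ ∕ infinite
volume ∕ OS ∕ mass gap ∕ Clay.
-/

noncomputable section

namespace Literature.MathematicalPhysics.QuantumFieldTheory.Balaban1983to89.Node00

open DagBinding
open B6KLevelCensusIndexV1 (KIdx kGeoG)
open B6Prop26Census2136KLevelV1 (kG)

/-- `1 ≤ d₆` at an admissible `θ` (`D ≥ 2`, `d₆ + 1 = D`). [cite: Balaban1984PropagatorsII, (2.1) p.224, bookkeeping] -/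
theorem Stage3Params.one_le_d₆ (θ : Stage3Params) (hθ : θ.toStage1Params.Admissible) : 1 ≤ θ.d₆ := by
  have hD : 2 ≤ θ.D := hθ.1
  have h := θ.hd₆
  omega

/-- `1 ≤ ℓ₆` (`L = ℓ₆ + 1 > 1`). [cite: Balaban1987RG1, p.253, bookkeeping] -/
theorem Stage3Params.one_le_ℓ₆ (θ : Stage3Params) : 1 ≤ θ.ℓ₆ := by
  have h := θ.hL'.2
  omega

/-- **The block of record's leaf from the Prop. 2.6 census alone** (dag-p1's `b6BlockParam_tower_of_prop26` read at `θ`: `D6OfRecord θ` unfolds to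
`towerBlockOfRecord` with the carriers of record). [cite: Balaban1984PropagatorsII, pp.223–250 (Lemma 2.1 – Cor. 2.8; kernel versions of the lineages)] -/
theorem b6BlockParam_D6OfRecord_of_prop26 (θ : Stage3Params) (hθ : θ.toStage1Params.Admissible)
    (h26 : B6.Prop26Printed (fun i : KIdx θ.d₆ θ.ℓ₆ θ.hd' θ.hL' θ.b₀ θ.b₁ => kGeoG i) (fun i => kG i)) :
    B6BlockParam (D6OfRecord θ) :=
  b6BlockParam_tower_of_prop26 (θ.one_le_d₆ hθ) θ.one_le_ℓ₆ θ.hb.1 θ.hb.2 θ.hδ₀.1 θ.hδ₀.2 h26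

/-- **N03 · [Balaban1984PropagatorsII]: `Dag.B6_main (leavesP w P)` («b4 → b5 → b6») AT EVERY STAGE-3 WORLD OF RECORD, every run, MODULO EXACTLY THE
PROP. 2.6 CENSUS** on the genuine k-level family (stated for every parameter tuple `θ : Stage3Params`; r03's `B6.Prop26Printed (kGeoG) (kG)`).  The antecedents
b4, b5 are not consumed (the leaf is proved outright); when the census is a tree theorem this becomes N03 OF RECORD by one `fun θ => …`.
[cite: Balaban1984PropagatorsII, Lemma 2.1 p.234, Props. 2.2–2.3 pp.234–238, Lemma 2.4 p.245, Props. 2.5–2.7 pp.246–249, Cor. 2.8 p.249 (the stated block at the objects of record)] -/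
theorem b6_main_of_isWorldOfRecord₃_of_prop26
    (h26 : ∀ θ : Stage3Params, θ.toStage1Params.Admissible →
      B6.Prop26Printed (fun i : KIdx θ.d₆ θ.ℓ₆ θ.hd' θ.hL' θ.b₀ θ.b₁ => kGeoG i) (fun i => kG i))
    (w : WorldP) (hw : IsWorldOfRecord₃ w) (P : B12.RunParams) : Dag.B6_main (leavesP w P) :=
  b6_main_of_isWorldOfRecord₃_of (fun θ hθ => b6BlockParam_D6OfRecord_of_prop26 θ hθ (h26 θ hθ)) w hw P

/-- **All four first-cluster nodes at every Stage-3 world of record, modulo the Prop. 2.6 census**: N01 ∧ N02 ∧ N03 ∧ N04 (`Dag.B4_main ∧ B5_main ∧ B6_main ∧ B7_main`).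
[cite: Balaban1983RegularityDecay, Theorem p.573; Balaban1984PropagatorsI, Props. 1.1–1.2 pp.33–36; Balaban1984PropagatorsII, pp.223–250; Balaban1985Averaging, Props. 1–10 pp.26–50 (kernel versions of the lineages)] -/
theorem nodes_N01_N02_N03_N04_of_isWorldOfRecord₃_of_prop26
    (h26 : ∀ θ : Stage3Params, θ.toStage1Params.Admissible →
      B6.Prop26Printed (fun i : KIdx θ.d₆ θ.ℓ₆ θ.hd' θ.hL' θ.b₀ θ.b₁ => kGeoG i) (fun i => kG i))
    (w : WorldP) (hw : IsWorldOfRecord₃ w) (P : B12.RunParams) :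
    Dag.B4_main (leavesP w P) ∧ Dag.B5_main (leavesP w P) ∧ Dag.B6_main (leavesP w P) ∧ Dag.B7_main (leavesP w P) :=
  ⟨b4_main_of_isWorldOfRecord₃ w hw P, b5_main_of_isWorldOfRecord₃ w hw P, b6_main_of_isWorldOfRecord₃_of_prop26 h26 w hw P,
    b7_main_of_isWorldOfRecord₃ w hw P⟩

end Literature.MathematicalPhysics.QuantumFieldTheory.Balaban1983to89.Node00

end
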